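import Mathlib
import HarnessLib
import Summits.HubbardSuperconductivity.HubbardSuperconductivity.Theorems.KLProgrammeKLRegimeEngineTowerInstProfileLevRateBase
import Summits.HubbardSuperconductivity.HubbardSuperconductivity.Theorems.KLProgrammeKLRegimeEngineTowerInstRemeasureLevFBase

/-!
# Route `KLProgramme` — crux K3 ENGINE (stmt-HubbardSuperconductivity-20437 `KLRegimeEngineV17F2`), stub (b) v2, THE LEVELS PACKAGE (ℓ), instantiation (I2)/(I3):
# THE RE-BASED LEVELLED MEASURED PROFILE, FLOOR-KEYED («R-rows-F»: cures (A″) «(ℓ)-BLOCK0-LOGM» + (ε) «(ℓ)-LEV-ODD»; the PRODUCER of the bridge `hR` of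
# `klTowerBLevF_le_law_of_inputs_base`, …TowerLevLawBase; cell gate-hubbard-kl, seat p4 g19)

Floor-keyed twin of …TowerInstProfileLevRateBase on the arrays `klTowerBLevF/klTowerMuLevAtF/klTowerMuLevF` of …TowerLevFloorUnitsDefs (k3c2-p3 p668906).  The block
rate is `ρ_F = (2^d)⁻¹` and the per-family gain exponent `e_F = p + t − klLevGain t − 3 ≥ p − 3` (from `klTowerMuLevAtF_le_kitSum_base`), so the block gain is
`((2^{d−1})⁻¹)^{e_F} ≤ 8^{d−1}·((2^{d−1})⁻¹)^p` — the SAME `A′, Q′` shape as the half-keyed rows with the better rate: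
`A′ = 27⁵(C₁/C₂)8^{d−1}(A_b + A/(1 − (2^d)⁻¹))`, `Q′ = C₂²(2^{d−1})⁻¹·max Q Q_b`.

* §1 **`klTowerMuLevAtF_le_profileR_base`** (per track, capped; IH on the floor born arrays of blocks `2 … k`), §2 **`klTowerMuLevF_le_profileR_base`** (track-blind;
  `m = 3` modulo the located six-leg cell `klTowerMuLevAtF … d 0 k 3`), §3 **`klTowerBLevF_le_law_of_base_rows`** — `klTowerBLevF_le_law_of_inputs_base` with `hR`
  DISCHARGED; remaining NAMED inputs: the base datum rows `N_b`/unit law in FLOOR units (k3c2-p3's `gridLaw_div_klLevUnitF_le`, p670020), the block-1 profile,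
  the imports, the cell, the FLOOR-KEYED step («(I1)-LEV-FLOOR» LINK, to come) and the kit's numerics (unit-free, k3c3-p2 `towerLevNumericsG` at `r = (2^d)⁻¹`).
Compositions of landed theorems and real algebra; nothing about the model is asserted beyond them; nothing asserts (ℓ), any stub, K3 or superconductivity.
References: BGM 2006 §2.8 (2.83), (2.93)–(2.98), Lemma 2.5 [cite: BenfattoGiulianiMastropietro2006].
-/

noncomputable section

namespace Summit.HubbardSuperconductivity.HubbardSuperconductivity.Theorems.EngineV8

set_option linter.dupNamespace false -- summit = problem name (single-conjunct summit), D-0017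

open Classical
open Real Finset Literature.MathematicalPhysics.QuantumLattice Literature.Probability.LatticeModels GrassmannAlgebra
open Literature.MathematicalPhysics.QuantumLattice.FermiRG
open Summit.HubbardSuperconductivity.HubbardSuperconductivity.Theorems.KLProgrammeLegKernels
open Summit.HubbardSuperconductivity.HubbardSuperconductivity.Theorems.KLRegimeSplit
open Summit.HubbardSuperconductivity.HubbardSuperconductivity.Theorems.KLRegimeWick
open Summit.HubbardSuperconductivity.HubbardSuperconductivity.Theorems.TorusFourierL2
open Summit.HubbardSuperconductivity.HubbardSuperconductivity.Theorems.DispersionFlow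
open Summit.HubbardSuperconductivity.HubbardSuperconductivity.Theorems.PerturbedFermiCurve

variable {L M : ℕ} [NeZero L] [NeZero M]

/-! ## §1 The per-track re-based profile, floor-keyed, capped -/

omit [NeZero L] [NeZero M] in
/-- **THE RE-BASED LEVELLED MEASURED PROFILE FROM THE LAW, per track, RATE KEPT.**  Under the binders of `klTowerMuLevAtF_le_kitSum_base`, for `d ≥ 2`, `k ≥ 2`,
`dk − 1 ≤ nScales β + 1`, a degree cap `D`, nonnegative `A, λ, Q, A_b, Q_b`, base bounds `N_b t p` (levelled norms of `𝒱_d` at `F_{d−1}`) with the base law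
`N_b t p / klLevUnit … t p (d−1) ≤ A_b λ^{p−1} Q_b^p` (`3 ≤ p`) and the law `klTowerBLev … d t k′ p ≤ A λ^{p−1} Q^p` on the blocks `2 ≤ k′ ≤ k` (all tracks,
`3 ≤ p ≤ D`): for every `t : Fin 5`, `3 ≤ p ≤ D` with `2p + t ≥ 7`,
`klTowerMuLevAt … d t k p ≤ 27⁵(C₁/C₂)·8^{d−1}·(A_b + A/(1 − ((√2)^d)⁻¹))·λ^{p−1}·(C₂²(2^{d−1})⁻¹·max Q Q_b)^p`. [cite: BenfattoGiulianiMastropietro2006, §2.8 (2.83), (2.93)-(2.98)] -/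
theorem klTowerMuLevAtF_le_profileR_base :
    ∃ C₁ C₂ : ℝ, 0 < C₁ ∧ 0 < C₂ ∧ ∀ R : RenConsts, R.WF2 → ∃ c₃' : ℝ, 0 < c₃' ∧ ∃ U₀' : ℝ, 0 < U₀' ∧
      ∀ (P : SplitConsts) (c : ℝ), P.WF → 0 < c → c ≤ klEngC₃6 P R → c ≤ c₃' →
      ∀ μ ∈ klWindowC, ∀ U : ℝ, 0 < U → U ≤ klEngU₀9 P R c → U ≤ U₀' → ∀ β : ℝ, klBetaMin ≤ β → β ≤ Real.exp (c / U ^ 2) →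
      ∀ K : TrigPolyC4v, FrameOK R U (nScales β) μ K → ∀ (L M : ℕ) [NeZero L] [NeZero M],
      klEngL₃ β U ≤ L → klEngM₃ β U L ≤ M → ∀ d k : ℕ, 2 ≤ d → 2 ≤ k → d * k - 1 ≤ nScales β + 1 → ∀ D : ℕ,
      ∀ (A lam Q Ab Qb : ℝ), 0 ≤ A → 0 ≤ lam → 0 ≤ Q → 0 ≤ Ab → 0 ≤ Qb →
      ∀ Nb : Fin 5 → ℕ → ℝ, (∀ t p, 0 ≤ Nb t p) →
        (∀ (t : Fin 5) (p : ℕ) (Ωe' : Fin (2 * p) → Option (SectorLeg (sectorCount (d - 1)))), levelCount Ωe' = (t : ℕ) + 1 →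
          klLevNormOf L M β μ K (d - 1) (2 * p) (klTowerInput L M β U μ K d 1) Ωe' ≤ Nb t p) →
        (∀ (t : Fin 5) (p : ℕ), 3 ≤ p → Nb t p / klLevUnitF β M t p (d - 1) ≤ Ab * lam ^ (p - 1) * Qb ^ p) →
        (∀ k' : ℕ, 2 ≤ k' → k' ≤ k → ∀ (t : Fin 5) (p : ℕ), 3 ≤ p → p ≤ D → klTowerBLevF L M β U μ K d t k' p ≤ A * lam ^ (p - 1) * Q ^ p) →
      ∀ (t : Fin 5) (p : ℕ), 3 ≤ p → p ≤ D → 7 ≤ 2 * p + (t : ℕ) →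
        klTowerMuLevAtF L M β U μ K d t k p ≤
          (27 : ℝ) ^ 5 * (C₁ / C₂) * (8 : ℝ) ^ (d - 1) * (Ab + A / (1 - ((2 : ℝ) ^ d)⁻¹)) * lam ^ (p - 1) *
            (C₂ ^ 2 * ((2 : ℝ) ^ (d - 1))⁻¹ * max Q Qb) ^ p := by
  obtain ⟨C₁, C₂, hC₁, hC₂, h⟩ := klTowerMuLevAtF_le_kitSum_base
  refine ⟨C₁, C₂, hC₁, hC₂, fun R hR2 => ?_⟩
  obtain ⟨c₃, hc₃, U₀, hU₀, h'⟩ := h R hR2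
  refine ⟨c₃, hc₃, U₀, hU₀, ?_⟩
  intro P c hP hc hc6 hc₃' μ hμ U hU hU9 hU₀' β hβmin hβc K hK L M _ _ hL3 hM3 d k hd hk2 hkN D A lam Q Ab Qb hA hlam hQ hAb hQb Nb hNb0 hcar hlawb hIH
    t p hp hpD hpt
  have hβ : 0 < β := KLRegimeSplit.pos_of_klBetaMin_le hβmin
  have ht4 : (t : ℕ) ≤ 4 := by have := t.isLt; omega
  have hg := klLevGain_le t
  have hg2 : 2 * klLevGain t ≤ (t : ℕ) := by
    unfold klLevGain levelGainExp
    have := t.isLt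
    omega
  -- the rate `ρ = (2^d)⁻¹ ∈ (0, 1)` and the block gain `γ = (2^{d−1})⁻¹ ≤ 1`
  set ρ : ℝ := ((2 : ℝ) ^ d)⁻¹ with hρ
  have hsd1 : (1 : ℝ) < (2 : ℝ) ^ d := one_lt_pow₀ (by norm_num) (by omega)
  have hρ0 : 0 < ρ := by positivity
  have hρ1 : ρ < 1 := inv_lt_one_of_one_lt₀ hsd1
  have hρle : ρ ≤ 1 := hρ1.le
  have h1ρ : 0 < 1 - ρ := sub_pos.2 hρ1
  set γ : ℝ := ((2 : ℝ) ^ (d - 1))⁻¹ with hγ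
  have hγ0 : 0 ≤ γ := by positivity
  have hγ1 : γ ≤ 1 := inv_le_one_of_one_le₀ (one_le_pow₀ (by norm_num))
  -- the exponent `e = p + t − klLevGain t − 3 ≥ p − 3` and the gain `G = γ^e`
  set e : ℕ := p + (t : ℕ) - klLevGain t - 3 with he
  set G : ℝ := γ ^ e with hG
  have hG0 : 0 ≤ G := by positivity
  have hGle : G ≤ (8 : ℝ) ^ (d - 1) * (((2 : ℝ) ^ (d - 1))⁻¹) ^ p := by
    rw [hG]
    have h1 : γ ^ e ≤ γ ^ (p - 3) := pow_le_pow_of_le_one hγ0 hγ1 (by omega)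
    refine h1.trans (le_of_eq ?_)
    have h2 : (0 : ℝ) < (2 : ℝ) ^ (d - 1) := by positivity
    obtain ⟨q, rfl⟩ : ∃ q, p = q + 3 := ⟨p - 3, by omega⟩
    rw [Nat.add_sub_cancel, hγ, pow_add, inv_pow, inv_pow]
    have h8 : (8 : ℝ) ^ (d - 1) = ((2 : ℝ) ^ (d - 1)) ^ 3 := by
      rw [← pow_mul, mul_comm, pow_mul]; norm_num
    rw [h8]
    field_simp
  have hmain := h' P c hP hc hc6 hc₃' μ hμ U hU hU9 hU₀' β hβmin hβc K hK L M hL3 hM3 d k hd hk2 hkN t p (by omega) (by omega) (Nb t p)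
    (hNb0 t p) (hcar t p)
  -- laws
  set law : ℕ → ℝ := fun p => A * lam ^ (p - 1) * Q ^ p with hlaw
  have hlaw0 : 0 ≤ law p := by positivity
  have hu0 : 0 < klLevUnitF β M t p (d - 1) := klLevUnitF_pos hβ t p (d - 1)
  -- (i) the UV term carries `γ^e` (since `dk − 1 ≥ d − 1`)
  have hUVt : ((2 : ℝ) ^ e)⁻¹ ^ (d * (k - 1)) * (Nb t p / klLevUnitF β M t p (d - 1)) ≤ G * (Ab * lam ^ (p - 1) * Qb ^ p) := by
    have hb : ((2 : ℝ) ^ e)⁻¹ ≤ 1 := inv_le_one_of_one_le₀ (one_le_pow₀ (by norm_num))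
    have hb0 : 0 ≤ ((2 : ℝ) ^ e)⁻¹ := by positivity
    have hdk : d - 1 ≤ d * (k - 1) := by
      have : d * 1 ≤ d * (k - 1) := Nat.mul_le_mul_left d (by omega)
      omega
    have hpow : ((2 : ℝ) ^ e)⁻¹ ^ (d * (k - 1)) ≤ ((2 : ℝ) ^ e)⁻¹ ^ (d - 1) := pow_le_pow_of_le_one hb0 hb hdk
    have hGeq : ((2 : ℝ) ^ e)⁻¹ ^ (d - 1) = G := by
      rw [hG, hγ, inv_pow, inv_pow, ← pow_mul, ← pow_mul, mul_comm]
    have hq0 : 0 ≤ Nb t p / klLevUnitF β M t p (d - 1) := div_nonneg (hNb0 t p) hu0.le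
    calc ((2 : ℝ) ^ e)⁻¹ ^ (d * (k - 1)) * (Nb t p / klLevUnitF β M t p (d - 1)) ≤ G * (Nb t p / klLevUnitF β M t p (d - 1)) := by
          rw [← hGeq]; exact mul_le_mul_of_nonneg_right hpow hq0
      _ ≤ G * (Ab * lam ^ (p - 1) * Qb ^ p) := mul_le_mul_of_nonneg_left (hlawb t p hp) hG0
  -- (ii) the born sum: each term `≤ G·ρ^{k−1−k′}·law`, the sum `≤ G·law/(1−ρ)`
  have hterm : ∀ k' ∈ Ico 1 k, (2 : ℝ) ^ e * ρ ^ (e * (k - k')) * klTowerBLevF L M β U μ K d t (k' + 1) p ≤ G * ρ ^ (k - 1 - k') * law p := by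
    intro k' hk'
    obtain ⟨hk'1, hk'⟩ := mem_Ico.1 hk'
    obtain ⟨n, hn⟩ : ∃ n, k - k' = n + 1 := ⟨k - k' - 1, by omega⟩
    have hkn : k - 1 - k' = n := by omega
    have hb : klTowerBLevF L M β U μ K d t (k' + 1) p ≤ law p := hIH (k' + 1) (by omega) (by omega) t p hp hpD
    have hb0 : 0 ≤ klTowerBLevF L M β U μ K d t (k' + 1) p := klTowerBLevF_nonneg hβ U μ K d t (k' + 1) p
    have hrate : (2 : ℝ) ^ e * ρ ^ (e * (k - k')) ≤ G * ρ ^ (k - 1 - k') := by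
      rw [hn, hkn, show e * (n + 1) = e + e * n by ring, pow_add, ← mul_assoc]
      have h1 : (2 : ℝ) ^ e * ρ ^ e = G := by rw [hG, hγ, hρ]; exact two_pow_mul_inv_pow_eq_F (by omega) e
      have h2 : ρ ^ (e * n) ≤ ρ ^ n := by
        rw [mul_comm, pow_mul]
        exact pow_le_of_le_one (by positivity) (pow_le_one₀ hρ0.le hρle) (by omega)
      rw [h1]
      exact mul_le_mul_of_nonneg_left h2 hG0
    calc (2 : ℝ) ^ e * ρ ^ (e * (k - k')) * klTowerBLevF L M β U μ K d t (k' + 1) p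
        ≤ G * ρ ^ (k - 1 - k') * klTowerBLevF L M β U μ K d t (k' + 1) p := mul_le_mul_of_nonneg_right hrate hb0
      _ ≤ G * ρ ^ (k - 1 - k') * law p := mul_le_mul_of_nonneg_left hb (by positivity)
  have hsum : ∑ k' ∈ Ico 1 k, (2 : ℝ) ^ e * ρ ^ (e * (k - k')) * klTowerBLevF L M β U μ K d t (k' + 1) p ≤ G * (law p / (1 - ρ)) := by
    refine (sum_le_sum hterm).trans ?_
    have hsub : Ico 1 k ⊆ range k := fun k' hk' => mem_range.2 (mem_Ico.1 hk').2
    refine (sum_le_sum_of_subset_of_nonneg hsub (fun k' _ _ => by positivity)).trans ?_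
    have hre : ∑ k' ∈ range k, G * ρ ^ (k - 1 - k') * law p = G * ((∑ j ∈ range k, ρ ^ j) * law p) := by
      rw [← sum_range_reflect (fun j => ρ ^ j) k, sum_mul, mul_sum]
      refine sum_congr rfl fun k' _ => ?_
      ring
    rw [hre]
    refine mul_le_mul_of_nonneg_left ?_ hG0
    calc (∑ j ∈ range k, ρ ^ j) * law p ≤ 1 / (1 - ρ) * law p :=
          mul_le_mul_of_nonneg_right (geom_sum_range_le_inv_one_sub hρ0.le hρ1 k) hlaw0
      _ = law p / (1 - ρ) := by rw [one_div, inv_mul_eq_div]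
  -- (iii) assemble
  have hpre0 : 0 ≤ (27 : ℝ) ^ ((t : ℕ) + 1) * (C₁ * C₂ ^ (2 * p - 1)) := by positivity
  have h27 : (27 : ℝ) ^ ((t : ℕ) + 1) ≤ 27 ^ 5 := pow_le_pow_right₀ (by norm_num) (by omega)
  set Mq := max Q Qb with hMq
  have hQM : Q ≤ Mq := le_max_left _ _
  have hQbM : Qb ≤ Mq := le_max_right _ _
  have hMq0 : 0 ≤ Mq := hQ.trans hQM
  set δ : ℝ := ((2 : ℝ) ^ (d - 1))⁻¹ with hδ
  have hδ0 : 0 ≤ δ := by positivity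
  have hin : Ab * lam ^ (p - 1) * Qb ^ p + law p / (1 - ρ) ≤ (Ab + A / (1 - ρ)) * lam ^ (p - 1) * Mq ^ p := by
    have h1 : Ab * lam ^ (p - 1) * Qb ^ p ≤ Ab * lam ^ (p - 1) * Mq ^ p :=
      mul_le_mul_of_nonneg_left (pow_le_pow_left₀ hQb hQbM p) (by positivity)
    have h2 : law p / (1 - ρ) ≤ A / (1 - ρ) * lam ^ (p - 1) * Mq ^ p := by
      rw [hlaw]; dsimp only
      rw [div_eq_mul_inv, show A / (1 - ρ) * lam ^ (p - 1) * Mq ^ p = A * lam ^ (p - 1) * Mq ^ p * (1 - ρ)⁻¹ by ring]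
      exact mul_le_mul_of_nonneg_right (mul_le_mul_of_nonneg_left (pow_le_pow_left₀ hQ hQM p) (by positivity))
        (inv_nonneg.2 h1ρ.le)
    calc Ab * lam ^ (p - 1) * Qb ^ p + law p / (1 - ρ) ≤ Ab * lam ^ (p - 1) * Mq ^ p + A / (1 - ρ) * lam ^ (p - 1) * Mq ^ p :=
          add_le_add h1 h2
      _ = (Ab + A / (1 - ρ)) * lam ^ (p - 1) * Mq ^ p := by ring
  have hA0 : 0 ≤ Ab + A / (1 - ρ) := by have : 0 ≤ A / (1 - ρ) := div_nonneg hA h1ρ.le; positivity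
  have hin0 : 0 ≤ (Ab + A / (1 - ρ)) * lam ^ (p - 1) * Mq ^ p := by positivity
  have hC : C₁ * C₂ ^ (2 * p - 1) = C₁ / C₂ * (C₂ ^ 2) ^ p := by
    have hpw : (C₂ ^ 2) ^ p = C₂ ^ (2 * p - 1) * C₂ := by
      rw [← pow_mul, ← pow_succ]; congr 1; omega
    rw [hpw]
    field_simp
  calc klTowerMuLevAtF L M β U μ K d t k p
      ≤ (27 : ℝ) ^ ((t : ℕ) + 1) * (C₁ * C₂ ^ (2 * p - 1)) *
          (((2 : ℝ) ^ e)⁻¹ ^ (d * (k - 1)) * (Nb t p / klLevUnitF β M t p (d - 1)) +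
            ∑ k' ∈ Ico 1 k, (2 : ℝ) ^ e * ρ ^ (e * (k - k')) * klTowerBLevF L M β U μ K d t (k' + 1) p) := hmain
    _ ≤ (27 : ℝ) ^ ((t : ℕ) + 1) * (C₁ * C₂ ^ (2 * p - 1)) * (G * (Ab * lam ^ (p - 1) * Qb ^ p) + G * (law p / (1 - ρ))) :=
        mul_le_mul_of_nonneg_left (add_le_add hUVt hsum) hpre0
    _ = (27 : ℝ) ^ ((t : ℕ) + 1) * (C₁ * C₂ ^ (2 * p - 1)) * G * (Ab * lam ^ (p - 1) * Qb ^ p + law p / (1 - ρ)) := by ring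
    _ ≤ (27 : ℝ) ^ 5 * (C₁ * C₂ ^ (2 * p - 1)) * ((8 : ℝ) ^ (d - 1) * δ ^ p) * ((Ab + A / (1 - ρ)) * lam ^ (p - 1) * Mq ^ p) := by
        have hsum0 : 0 ≤ Ab * lam ^ (p - 1) * Qb ^ p + law p / (1 - ρ) := add_nonneg (by positivity) (div_nonneg hlaw0 h1ρ.le)
        have h1 : (27 : ℝ) ^ ((t : ℕ) + 1) * (C₁ * C₂ ^ (2 * p - 1)) * G ≤ 27 ^ 5 * (C₁ * C₂ ^ (2 * p - 1)) * ((8 : ℝ) ^ (d - 1) * δ ^ p) :=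
          mul_le_mul (mul_le_mul_of_nonneg_right h27 (by positivity)) hGle hG0 (by positivity)
        exact mul_le_mul h1 hin hsum0 (by positivity)
    _ = (27 : ℝ) ^ 5 * (C₁ / C₂) * (8 : ℝ) ^ (d - 1) * (Ab + A / (1 - ρ)) * lam ^ (p - 1) * (C₂ ^ 2 * δ * Mq) ^ p := by
        rw [hC, mul_pow, mul_pow]; ring

/-! ## §2 The track-blind re-based profile, floor-keyed -/

omit [NeZero L] [NeZero M] in
/-- **THE TRACK-BLIND RE-BASED MEASURED PROFILE, RATE KEPT, capped** (`k ≥ 2`): (a) `m ∈ [4, D]`: `klTowerMuLev … d k m ≤ A′λ^{m−1}Q′^m`; (b) `m = 3 ≤ D`: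
given `X ≥ klTowerMuLevAt … d 0 k 3` (the located cell), `klTowerMuLev … d k 3 ≤ max X (A′λ²Q′³)`; `A′ = 27⁵(C₁/C₂)8^{d−1}(A_b + A/(1−((√2)^d)⁻¹))`,
`Q′ = C₂²(2^{d−1})⁻¹·max Q Q_b`. [cite: BenfattoGiulianiMastropietro2006, §2.8 (2.83), (2.93)-(2.98)] -/
theorem klTowerMuLevF_le_profileR_base :
    ∃ C₁ C₂ : ℝ, 0 < C₁ ∧ 0 < C₂ ∧ ∀ R : RenConsts, R.WF2 → ∃ c₃' : ℝ, 0 < c₃' ∧ ∃ U₀' : ℝ, 0 < U₀' ∧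
      ∀ (P : SplitConsts) (c : ℝ), P.WF → 0 < c → c ≤ klEngC₃6 P R → c ≤ c₃' →
      ∀ μ ∈ klWindowC, ∀ U : ℝ, 0 < U → U ≤ klEngU₀9 P R c → U ≤ U₀' → ∀ β : ℝ, klBetaMin ≤ β → β ≤ Real.exp (c / U ^ 2) →
      ∀ K : TrigPolyC4v, FrameOK R U (nScales β) μ K → ∀ (L M : ℕ) [NeZero L] [NeZero M],
      klEngL₃ β U ≤ L → klEngM₃ β U L ≤ M → ∀ d k : ℕ, 2 ≤ d → 2 ≤ k → d * k - 1 ≤ nScales β + 1 → ∀ D : ℕ,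
      ∀ (A lam Q Ab Qb : ℝ), 0 ≤ A → 0 ≤ lam → 0 ≤ Q → 0 ≤ Ab → 0 ≤ Qb →
      ∀ Nb : Fin 5 → ℕ → ℝ, (∀ t p, 0 ≤ Nb t p) →
        (∀ (t : Fin 5) (p : ℕ) (Ωe' : Fin (2 * p) → Option (SectorLeg (sectorCount (d - 1)))), levelCount Ωe' = (t : ℕ) + 1 →
          klLevNormOf L M β μ K (d - 1) (2 * p) (klTowerInput L M β U μ K d 1) Ωe' ≤ Nb t p) →
        (∀ (t : Fin 5) (p : ℕ), 3 ≤ p → Nb t p / klLevUnitF β M t p (d - 1) ≤ Ab * lam ^ (p - 1) * Qb ^ p) →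
        (∀ k' : ℕ, 2 ≤ k' → k' ≤ k → ∀ (t : Fin 5) (p : ℕ), 3 ≤ p → p ≤ D → klTowerBLevF L M β U μ K d t k' p ≤ A * lam ^ (p - 1) * Q ^ p) →
      (∀ m : ℕ, 4 ≤ m → m ≤ D →
        klTowerMuLevF L M β U μ K d k m ≤
          (27 : ℝ) ^ 5 * (C₁ / C₂) * (8 : ℝ) ^ (d - 1) * (Ab + A / (1 - ((2 : ℝ) ^ d)⁻¹)) * lam ^ (m - 1) *
            (C₂ ^ 2 * ((2 : ℝ) ^ (d - 1))⁻¹ * max Q Qb) ^ m) ∧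
      (∀ X : ℝ, 3 ≤ D → klTowerMuLevAtF L M β U μ K d 0 k 3 ≤ X →
        klTowerMuLevF L M β U μ K d k 3 ≤
          max X ((27 : ℝ) ^ 5 * (C₁ / C₂) * (8 : ℝ) ^ (d - 1) * (Ab + A / (1 - ((2 : ℝ) ^ d)⁻¹)) * lam ^ 2 *
            (C₂ ^ 2 * ((2 : ℝ) ^ (d - 1))⁻¹ * max Q Qb) ^ 3)) := by
  obtain ⟨C₁, C₂, hC₁, hC₂, h⟩ := klTowerMuLevAtF_le_profileR_base
  refine ⟨C₁, C₂, hC₁, hC₂, fun R hR2 => ?_⟩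
  obtain ⟨c₃, hc₃, U₀, hU₀, h'⟩ := h R hR2
  refine ⟨c₃, hc₃, U₀, hU₀, ?_⟩
  intro P c hP hc hc6 hc₃' μ hμ U hU hU9 hU₀' β hβmin hβc K hK L M _ _ hL3 hM3 d k hd hk2 hkN D A lam Q Ab Qb hA hlam hQ hAb hQb Nb hNb0 hcar hlawb hIH
  have hcell := h' P c hP hc hc6 hc₃' μ hμ U hU hU9 hU₀' β hβmin hβc K hK L M hL3 hM3 d k hd hk2 hkN D A lam Q Ab Qb hA hlam hQ hAb hQb Nb hNb0 hcar hlawb hIH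
  refine ⟨fun m hm hmD => ?_, fun X hD3 hX => ?_⟩
  · obtain ⟨t, ht⟩ := exists_klTowerMuLevF_eq (L := L) (M := M) β U μ K d k m
    rw [ht]
    exact hcell t m (by omega) hmD (by omega)
  · obtain ⟨t, ht⟩ := exists_klTowerMuLevF_eq (L := L) (M := M) β U μ K d k 3
    rw [ht]
    by_cases ht0 : (t : ℕ) = 0
    · have : t = 0 := Fin.ext ht0
      rw [this]
      exact hX.trans (le_max_left _ _)
    · have h7 : 7 ≤ 2 * 3 + (t : ℕ) := by omega
      have := hcell t 3 le_rfl hD3 h7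
      exact this.trans (le_max_right _ _)

/-! ## §3 The re-based floor-keyed law with the bridge discharged -/

omit [NeZero L] [NeZero M] in
/-- **THE RE-BASED LEVELLED TOWER LAW, BRIDGE DISCHARGED** — `klTowerBLevF_le_law_of_inputs_base` with `hR` from `klTowerMuLevF_le_profileR_base`: under the
binders of the re-measurement rows, given the base datum `N_b` with its unit law, the block-`1` profile, the imports at `k ≥ 1`, the six-leg cell bound
`klTowerMuLevAt … d 0 k 3 ≤ Xλ²` (`2 ≤ k < K_b`), the step at `k ≥ 1` and the kit's numerics at `A′ ≥ W·27⁵(C₁/C₂)8^{d−1}(A_b + A/(1−((√2)^d)⁻¹))`,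
`Q′ ≥ Z·C₂²(2^{d−1})⁻¹·max Q Q_b`, `ι₃ ≥ max(WZ³X, A′Q′³)`: every born array of the blocks `2 ≤ k ≤ K_b` obeys `klTowerBLev … d t k p ≤ Aλ^{p−1}Q^p`.
[cite: BenfattoGiulianiMastropietro2006, §2.8 (2.83), (2.93)-(2.98)] -/
theorem klTowerBLevF_le_law_of_base_rows :
    ∃ C₁ C₂ : ℝ, 0 < C₁ ∧ 0 < C₂ ∧ ∀ R : RenConsts, R.WF2 → ∃ c₃' : ℝ, 0 < c₃' ∧ ∃ U₀' : ℝ, 0 < U₀' ∧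
      ∀ (P : SplitConsts) (c : ℝ), P.WF → 0 < c → c ≤ klEngC₃6 P R → c ≤ c₃' →
      ∀ μ ∈ klWindowC, ∀ U : ℝ, 0 < U → U ≤ klEngU₀9 P R c → U ≤ U₀' → ∀ β : ℝ, klBetaMin ≤ β → β ≤ Real.exp (c / U ^ 2) →
      ∀ K : TrigPolyC4v, FrameOK R U (nScales β) μ K → ∀ (L M : ℕ) [NeZero L] [NeZero M],
      klEngL₃ β U ≤ L → klEngM₃ β U L ≤ M → ∀ d Kb D : ℕ, 2 ≤ d → d * Kb - 1 ≤ nScales β + 1 → 3 ≤ D →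
      ∀ (A lam Q Ab Qb : ℝ), 0 ≤ A → 0 < lam → 0 < Q → 0 ≤ Ab → 0 ≤ Qb →
      -- the base datum at the family `F_{d−1}` and its unit law (k3c2-p3 «(ℓ)-BASE-LEV» p668143 / p670020 from p3's grid step)
      ∀ Nb : Fin 5 → ℕ → ℝ, (∀ t p, 0 ≤ Nb t p) →
        (∀ (t : Fin 5) (p : ℕ) (Ωe' : Fin (2 * p) → Option (SectorLeg (sectorCount (d - 1)))), levelCount Ωe' = (t : ℕ) + 1 →
          klLevNormOf L M β μ K (d - 1) (2 * p) (klTowerInput L M β U μ K d 1) Ωe' ≤ Nb t p) →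
        (∀ (t : Fin 5) (p : ℕ), 3 ≤ p → Nb t p / klLevUnitF β M t p (d - 1) ≤ Ab * lam ^ (p - 1) * Qb ^ p) →
      ∀ (W Z A' Q' : ℝ), 0 < W → 0 < Z →
        W * ((27 : ℝ) ^ 5 * (C₁ / C₂) * (8 : ℝ) ^ (d - 1) * (Ab + A / (1 - ((2 : ℝ) ^ d)⁻¹))) ≤ A' →
        Z * (C₂ ^ 2 * ((2 : ℝ) ^ (d - 1))⁻¹ * max Q Qb) ≤ Q' → 0 < Q' →
      ∀ (σ Φ ψ τ ι₁ ι₂ ι₃ X : ℝ), 0 ≤ σ → 0 ≤ Φ → 0 ≤ ψ → 0 < τ → W * Z ^ 3 * X ≤ ι₃ → A' * Q' ^ 3 ≤ ι₃ →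
      -- the block-1 profile (named)
      (∀ m, 4 ≤ m → m ≤ D → W * Z ^ m * klTowerMuLevF L M β U μ K d 1 m ≤ A' * lam ^ (m - 1) * Q' ^ m) →
      (3 ≤ D → W * Z ^ 3 * klTowerMuLevF L M β U μ K d 1 3 ≤ ι₃ * lam ^ 2) →
      -- the imports (E1 (I4))
      (∀ k, 1 ≤ k → k < Kb → W * Z ^ 1 * klTowerMuLevF L M β U μ K d k 1 ≤ ι₁ * lam) →
      (∀ k, 1 ≤ k → k < Kb → W * Z ^ 2 * klTowerMuLevF L M β U μ K d k 2 ≤ ι₂ * lam) →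
      -- the located six-leg cell «(I2)-F1-HMU» at the blocks `k ≥ 2`
      (∀ k, 2 ≤ k → k < Kb → klTowerMuLevAtF L M β U μ K d 0 k 3 ≤ X * lam ^ 2) →
      -- the step at blocks `k ≥ 1` (p664283 / p666413 §1 verbatim)
      (∀ t : Fin 5, ∀ k, 1 ≤ k → k < Kb → ∀ N : ℕ, 2 ≤ N → ∀ p, 3 ≤ p → p ≤ D →
        Φ * towerV D τ (fun m => W * Z ^ m * klTowerMuLevF L M β U μ K d k m) < 1 →
        klTowerBLevF L M β U μ K d t (k + 1) p ≤
          towerFO D σ (fun m => W * Z ^ m * klTowerMuLevF L M β U μ K d k m) p +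
            ∑ n ∈ Icc 2 N, exp 1 * Φ ^ (n - 1) * ψ ^ p * towerS D τ (fun m => W * Z ^ m * klTowerMuLevF L M β U μ K d k m) n p +
            ψ ^ p * exp 1 * towerV D τ (fun m => W * Z ^ m * klTowerMuLevF L M β U μ K d k m) *
              (Φ * towerV D τ (fun m => W * Z ^ m * klTowerMuLevF L M β U μ K d k m)) ^ N /
              (1 - Φ * towerV D τ (fun m => W * Z ^ m * klTowerMuLevF L M β U μ K d k m))) →
      -- the kit's numerics (E1 (I5))
      4 * σ * lam * Q' < 1 → 2 * lam * τ * Q' ≤ 1 → exp 1 * τ * lam * Q' < 1 →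
      Φ * (τ * (ι₁ * lam + ι₂ / (2 * Q') + ι₃ / (4 * Q' ^ 2) + A' * Q' / 4)) < 1 →
      Φ * (exp 1 * τ * (ι₁ * lam) + (exp 1 * τ) ^ 2 * (ι₂ * lam) + (exp 1 * τ) ^ 3 * (ι₃ * lam ^ 2) +
        A' * (exp 1 * τ * Q') * ((exp 1 * τ * lam * Q') ^ 3 / (1 - exp 1 * τ * lam * Q'))) < 1 →
      4 * Q' ≤ Q → 2 * τ * ψ * Q' ≤ Q →
      A' * (4 * Q') ^ 3 * (4 * σ * lam * Q' / (1 - 4 * σ * lam * Q')) +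
        exp 1 * ψ * (2 * τ * ψ * Q') ^ 2 * (τ * (ι₁ * lam + ι₂ / (2 * Q') + ι₃ / (4 * Q' ^ 2) + A' * Q' / 4)) *
          (Φ * (τ * (ι₁ * lam + ι₂ / (2 * Q') + ι₃ / (4 * Q' ^ 2) + A' * Q' / 4)) /
            (1 - Φ * (τ * (ι₁ * lam + ι₂ / (2 * Q') + ι₃ / (4 * Q' ^ 2) + A' * Q' / 4)))) ≤ A * Q ^ 3 →
      ∀ k, 2 ≤ k → k ≤ Kb → ∀ (t : Fin 5) (p : ℕ), 3 ≤ p → p ≤ D →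
        klTowerBLevF L M β U μ K d t k p ≤ A * lam ^ (p - 1) * Q ^ p := by
  obtain ⟨C₁, C₂, hC₁, hC₂, h⟩ := klTowerMuLevF_le_profileR_base
  refine ⟨C₁, C₂, hC₁, hC₂, fun R hR2 => ?_⟩
  obtain ⟨c₃, hc₃, U₀, hU₀, h'⟩ := h R hR2
  refine ⟨c₃, hc₃, U₀, hU₀, ?_⟩
  intro P c hP hc hc6 hc₃' μ hμ U hU hU9 hU₀' β hβmin hβc K hK L M _ _ hL3 hM3 d Kb D hd hKbN hD A lam Q Ab Qb hA hlam hQ hAb hQb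
    Nb hNb0 hcar hlawb W Z A' Q' hW hZ hA'1 hQ'1 hQ'0 σ Φ ψ τ ι₁ ι₂ ι₃ X hσ hΦ hψ hτ hXι hAQι hbase hbase3 hι₁ hι₂ hcell hstep
    hx₁ hx₂ hx₃ hy hθ hu₁ hu₂ hclose
  have hβ : 0 < β := KLRegimeSplit.pos_of_klBetaMin_le hβmin
  -- the profile constants of the base `R` rows and their domination by `A′, Q′`
  set AR : ℝ := (27 : ℝ) ^ 5 * (C₁ / C₂) * (8 : ℝ) ^ (d - 1) * (Ab + A / (1 - ((2 : ℝ) ^ d)⁻¹)) with hAR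
  set QR : ℝ := C₂ ^ 2 * ((2 : ℝ) ^ (d - 1))⁻¹ * max Q Qb with hQR
  have hρ1 : ((2 : ℝ) ^ d)⁻¹ < 1 := inv_lt_one_of_one_lt₀ (one_lt_pow₀ (by norm_num) (by omega))
  have hAR0 : 0 ≤ AR := by
    have : 0 ≤ A / (1 - ((2 : ℝ) ^ d)⁻¹) := div_nonneg hA (sub_nonneg.2 hρ1.le)
    positivity
  have hQR0 : 0 ≤ QR := by
    have : 0 ≤ max Q Qb := le_max_of_le_left hQ.le
    positivity
  have hA'0 : 0 ≤ A' := le_trans (by positivity) hA'1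
  have hdom : ∀ m : ℕ, W * Z ^ m * (AR * lam ^ (m - 1) * QR ^ m) ≤ A' * lam ^ (m - 1) * Q' ^ m := fun m => by
    rw [show W * Z ^ m * (AR * lam ^ (m - 1) * QR ^ m) = W * AR * lam ^ (m - 1) * (Z * QR) ^ m by rw [mul_pow]; ring]
    exact mul_le_mul (mul_le_mul_of_nonneg_right hA'1 (pow_nonneg hlam.le _)) (pow_le_pow_left₀ (by positivity) hQ'1 m)
      (pow_nonneg (by positivity) _) (by positivity)
  have hWZ : ∀ m : ℕ, 0 ≤ W * Z ^ m := fun m => by positivity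
  have hkN : ∀ k, k < Kb → d * k - 1 ≤ nScales β + 1 := fun k hk =>
    le_trans (Nat.sub_le_sub_right (Nat.mul_le_mul_left d hk.le) 1) hKbN
  refine klTowerBLevF_le_law_of_inputs_base hβ U μ K d Kb D hA hlam hQ.le hW.le hZ.le hA'0 hQ'0 hσ hΦ hψ hτ hbase hbase3 ?_
    hι₁ hι₂ hstep hx₁ hx₂ hx₃ hy hθ hu₁ hu₂ hclose
  -- the bridge `hR` at the blocks `k ≥ 2`, from the re-based `R` rows
  intro k hk2 hkK ih
  have hrow := h' P c hP hc hc6 hc₃' μ hμ U hU hU9 hU₀' β hβmin hβc K hK L M hL3 hM3 d k hd hk2 (hkN k hkK) D A lam Q Ab Qb hA hlam.le hQ.le hAb hQb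
    Nb hNb0 hcar hlawb ih
  refine ⟨fun m hm hmD => (mul_le_mul_of_nonneg_left (hrow.1 m hm hmD) (hWZ m)).trans (hdom m), fun hD3 => ?_⟩
  refine (mul_le_mul_of_nonneg_left (hrow.2 (X * lam ^ 2) hD3 (hcell k hk2 hkK)) (hWZ 3)).trans ?_
  rw [mul_max_of_nonneg _ _ (hWZ 3)]
  refine max_le ?_ ?_
  · calc W * Z ^ 3 * (X * lam ^ 2) = W * Z ^ 3 * X * lam ^ 2 := by ring
      _ ≤ ι₃ * lam ^ 2 := mul_le_mul_of_nonneg_right hXι (sq_nonneg _)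
  · calc W * Z ^ 3 * (AR * lam ^ 2 * QR ^ 3) = W * Z ^ 3 * (AR * lam ^ (3 - 1) * QR ^ 3) := by norm_num
      _ ≤ A' * lam ^ (3 - 1) * Q' ^ 3 := hdom 3
      _ = A' * Q' ^ 3 * lam ^ 2 := by ring
      _ ≤ ι₃ * lam ^ 2 := mul_le_mul_of_nonneg_right hAQι (sq_nonneg _)

end Summit.HubbardSuperconductivity.HubbardSuperconductivity.Theorems.EngineV8

end
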